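import Literature.MathematicalPhysics.QuantumFieldTheory.Balaban1983to89.B9Thm312WholeDirBC
import Literature.MathematicalPhysics.QuantumFieldTheory.Balaban1983to89.B9Thm313WholeHolderZ
import Literature.MathematicalPhysics.QuantumFieldTheory.Balaban1983to89.B9Thm313WholeDirZ
import Literature.MathematicalPhysics.QuantumFieldTheory.Balaban1983to89.B9RWSumsDefinitePinsPairM
import Summits.QuantumFields.YangMills.Theorems.UnitScaleTiltProp7SectET3G0LayerFromThm310
import Summits.QuantumFields.YangMills.Theorems.UnitScaleTiltProp7SectET3N06LeavesRelZ
import HarnessLib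

/-!
# Route `UnitScaleTilt`, crux «MinimiserStabilityRegPr» (stmt-QuantumFields-19200, v10 stub EX, route (α), node N06(d = 3)) — THE β∕ε-INDEXED PERTURBATION
# STEPS `StepDirB` (AND THE LEFT STEP `LeftStep`) OF THE T³ LEAVES DERIVED FROM THE (3.131)∕(3.137) LETTER LAYER: the `KIdx`∕`geo9K` twin of Track A's
# `BalabanUVNodes.N06StepDirLayerAtPinsBCZ.stepDirB_layer_of_lettersCZ`

Cell `ym3-torus` (HUMAN RULING D-0037, YM ladder rung R3 — NOT the Clay problem); desk `ym-inputs` (D-0154 (2), INPUT-LIST v5 §4 row p03 = I-06 (b) «the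
Sect.-D perturbation-step rows»), seat ym-inputs-p03.  Count-neutral helper (`--supports stmt-QuantumFields-20520 --as helper`, the token this seat holds;
RULING g26-№2: B0 of (O″χ) needs N06(d = 3)); registry untouched; THEOREMS ONLY (0 `def`, 0 `sorry`); NOTHING of [Balaban1985BackgroundPropagators] is asserted.

THE PRINT.  [B9] p. 421: *"It is easy to find estimates for the operator Δ′_π, using Theorem 3.1 and the inequality (3.49) … One of the three derivatives
there has to be applied either to an expression on the right, or on the left, of Δ′_π"*; (3.131) p. 422; p. 423: *"|(Δ⁽²⁾A)(b)| ≦ O(1)Mα₀(Lʲη)⁻²|A| (3.137)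
… we have derivatives in the operator Δ′_π + Δ⁽²⁾_π which have to be applied either to the operator on the right, or on the left"*; Theorem 3.12 p. 423.

WHAT.  The record-species T³ leaf `Prop7SectET3N06LeavesRecord.t313_of_pins_T3_completePairMBZ` (★w1-20520 g3, ✓ p604909; the text of record of the
`norm_G` ∕ `norm_H₁` rows of the EX knit, OWNER RULING g25-№2) displays, among its analytic rows, the direction-indexed perturbation steps `hstepD : … →
StepDirB (𝔬 i) (𝔭 i) (Dd i) (Dds i) 1 (H₀ i) (bHX i) _ (θD·(Mα₀)) (fun β => θH β·(Mα₀)) (fun ε => θI ε·(Mα₀)) δK U`, the left steps `hleft : … → LeftStep …`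
and the block-L² step `hstepL2 : … → StepL2 …`.  At d = 4 the certificate of record (dag-n06-d editions ≥ 24, `…V6EPairNI∕NJ∕NK`) no longer displays
`hstepD`∕`hleft`: they are DERIVED from print's (3.131)∕(3.137) letter schemas (dag-n06-l `Letters3131`, `Letters3131H`, `Letters3131R`), Theorem-3.3-type
members of G₀ (`Thm33G0Dir`, `Thm33G0DirR`, `Thm33G0DirX`, `Thm33G0DivR`), the Z-species Q\*-letters (`Letters313HZ`, `Letters313DMZ`) and the R2-loc
class relation, by the helper `N06StepDirLayerAtPinsBCZ.stepDirB_layer_of_lettersCZ` over def-Y's index `MemberY ∕ geo9Y`.  ★w1-20520 g3's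
`Prop7SectET3G0LayerFromThm310` ported the G₀ layer (and the two sup-class `Step`s) to the T³ index `KIdx 2 ℓ hd3 hL b₀ b₁ ∕ geo9K`; THIS FILE ports the
StepDir layer: ★★ `stepDirB_layer_T3_of_lettersCZ` — statement, choices and proof VERBATIM those of the BCZ helper with `MemberY ↦ KIdx 2 ℓ hd3 hL b₀ b₁`,
`geo9Y ↦ geo9K`, `lemma21Pack_geo9Y ↦ lemma21Pack_geo9K` (★w1 g3), `rowSum261_geo9Y ↦ rowSum261_geo9K` (n06-i), backgrounds `bg` generic.
WHAT THIS GIVES THE T³ KNIT.  With ★w1's G₀ layer (its `hleft'`, `hG0C` outputs feed `hleft h33 h33R` here) the next record-species edition can display, in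
place of `hleft`∕`hstepD`, the letter schemas `hL3131 hL3131H hR`, the two G₀ members `hX hdiv`, and the R2-loc facts `hvanishX hleX` at `Rel := RelB`
(multiplicity `Prop7SectET3N06LeavesRelZ.card_filter_relB_le`, distance `B9CoRealizesRelAtLetters.dist_eq_of_relB`) — one storey closer to print's
Theorem 3.1 ∕ (3.49) ∕ (3.36) (dag-n06-l `B9PerturbationMajorantLetters` reads the four Δ′_π letter majorants from exactly those schemas).
HONEST SCOPE: kernel bookkeeping (thresholds, one maximum, two functions by formula, one application of n06-l's CZ engine per member, four arithmetic
dominations); every letter schema remains a displayed HYPOTHESIS about the genuine operators; N06(d = 3) NOT discharged; nothing here claims EX, the crux,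
V3∕R3, d = 4 or the mass gap; rung R3, not Clay.

References: T. Bałaban, CMP **99** (1985) 389–434 [Balaban1985BackgroundPropagators] (Thm 3.12 p.423, (3.130)–(3.138) pp.421–423, (3.42)–(3.45) pp.397–398,
p.398 remark after (3.47)); CMP **96** (1984) 223–250 [Balaban1984PropagatorsII] (Lemma 2.1 (2.59)–(2.61) pp.233–234, (2.26) p.228).
-/

set_option autoImplicit false

noncomputable section

namespace Summit.QuantumFields.YangMills.Theorems.Prop7SectET3StepDirLayerFromLetters

open Literature.MathematicalPhysics.QuantumFieldTheory.Balaban1983to89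
open Literature.MathematicalPhysics.QuantumFieldTheory.Balaban1983to89.B9Thm34Ext (toB6)
open Literature.MathematicalPhysics.QuantumFieldTheory.Balaban1983to89.B11SectG (BlockNorm HasMaj RowSum)
open Literature.MathematicalPhysics.QuantumFieldTheory.Balaban1983to89.B9Thm312Whole (GeoOK cNorm)
open Literature.MathematicalPhysics.QuantumFieldTheory.Balaban1983to89.B9Thm312WholeClasses (cNormR)
open Literature.MathematicalPhysics.QuantumFieldTheory.Balaban1983to89.B9Thm312WholeLeft (LeftStep)
open Literature.MathematicalPhysics.QuantumFieldTheory.Balaban1983to89.B9Thm312WholeDir (Thm33G0Dir)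
open Literature.MathematicalPhysics.QuantumFieldTheory.Balaban1983to89.B9Thm312WholeDirB (StepDirB) open Literature.MathematicalPhysics.QuantumFieldTheory.Balaban1983to89.B9Thm312WholeDirBC (stepDirB_of_letters3131LRCZ)
open Literature.MathematicalPhysics.QuantumFieldTheory.Balaban1983to89.B9Thm313WholeDir (Thm33G0DirR) open Literature.MathematicalPhysics.QuantumFieldTheory.Balaban1983to89.B9Thm313WholeDirZ (Letters313DMZ)
open Literature.MathematicalPhysics.QuantumFieldTheory.Balaban1983to89.B9Thm313WholeHolderZ (Letters313HZ)
open Literature.MathematicalPhysics.QuantumFieldTheory.Balaban1983to89.B9Thm312WholeL2 (StepL2)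
open Literature.MathematicalPhysics.QuantumFieldTheory.Balaban1983to89.B9RWSums343Holder (HolderProbes)
open Literature.MathematicalPhysics.QuantumFieldTheory.Balaban1983to89.B9RWSums343to347Whole (Facts347)
open Literature.MathematicalPhysics.QuantumFieldTheory.Balaban1983to89.B9RWSumsDefinitePins (PinPrims)
open Literature.MathematicalPhysics.QuantumFieldTheory.Balaban1983to89.B9RWSums347DefiniteFaces (exp261)
open Literature.MathematicalPhysics.QuantumFieldTheory.Balaban1983to89.B6KLevelCensusIndexV1 (KIdx)
open Literature.MathematicalPhysics.QuantumFieldTheory.Balaban1983to89.B9GeoNormsKLevelV1 (geo9K)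
open Literature.MathematicalPhysics.QuantumFieldTheory.Balaban1983to89.B9GeoLemma21KLevelV1 (geo9K_len_pos rowSum261_geo9K)
open Summit.QuantumFields.YangMills.Theorems.Prop7SectET3Members (hd3)
open Summit.QuantumFields.YangMills.Theorems.Prop7SectET3G0LayerFromThm310 (lemma21Pack_geo9K)
open Summit.QuantumFields.YangMills.Theorems.Prop7SectET3N06LeavesRelZ (card_filter_relB_le)
open Literature.MathematicalPhysics.QuantumFieldTheory.Balaban1983to89.B9CoRealizesRelAtLetters (RelB relB_refl dist_eq_of_relB)
open Literature.MathematicalPhysics.QuantumFieldTheory.Balaban1983to89.B9Thm312WholeStepFrom3131 (Letters3131)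
open Literature.MathematicalPhysics.QuantumFieldTheory.Balaban1983to89.B9Thm312WholeLeftStepFrom3131 (Letters3131H)
open Literature.MathematicalPhysics.QuantumFieldTheory.Balaban1983to89.B9Thm312WholeStepDirFrom3131 (Thm33G0DirX)
open Literature.MathematicalPhysics.QuantumFieldTheory.Balaban1983to89.B9Thm312WholeRightStepFrom3131 (Letters3131R Thm33G0DivR)

variable {ℓ : ℕ} {hL : Odd (ℓ + 1) ∧ 1 < ℓ + 1} {b₀ b₁ : ℝ}
variable [∀ x : KIdx 2 ℓ hd3 hL b₀ b₁, Fintype (geo9K x).Site]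
variable {c35 : ℝ} {bg : KIdx 2 ℓ hd3 hL b₀ b₁ → B9.Backgrounds}

/-! ## §1 The StepDir layer at the T³ index (KIdx ∕ geo9K twin of the BCZ helper) -/

/-- the pointwise domination pattern with the cutting constant: `κ ≤ κM`, `0 ≤ b` and `2((a + κM·b)·t·c) ≤ θ` give
`2((a + κ·b)·(t·m)·c) ≤ θ·m`. [folklore] -/
private theorem dom_two {a κ κM b t m c θ : ℝ} (hκ : κ ≤ κM) (hb0 : 0 ≤ b)
    (ht : 0 ≤ t) (hm : 0 ≤ m) (hc : 0 ≤ c) (hθ : 2 * ((a + κM * b) * t * c) ≤ θ) : 2 * ((a + κ * b) * (t * m) * c) ≤ θ * m := by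
  have h1 : κ * b ≤ κM * b := mul_le_mul_of_nonneg_right hκ hb0
  have h2 : a + κ * b ≤ a + κM * b := by linarith only [h1]
  have h3 : (a + κ * b) * t * c ≤ (a + κM * b) * t * c := mul_le_mul_of_nonneg_right (mul_le_mul_of_nonneg_right h2 ht) hc
  calc 2 * ((a + κ * b) * (t * m) * c) = 2 * ((a + κ * b) * t * c) * m := by ring
    _ ≤ 2 * ((a + κM * b) * t * c) * m := mul_le_mul_of_nonneg_right (by linarith only [h3]) hm
    _ ≤ θ * m := mul_le_mul_of_nonneg_right hθ hm

/-- the pointwise domination with the lattice factor: `2(A·t·c·L) ≤ θ` gives `2(A·(t·m)·c·L) ≤ θ·m`. [folklore] -/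
private theorem dom_L {A t m c L θ : ℝ} (hm : 0 ≤ m) (hθ : 2 * (A * t * c * L) ≤ θ) : 2 * (A * (t * m) * c * L) ≤ θ * m := by
  calc 2 * (A * (t * m) * c * L) = 2 * (A * t * c * L) * m := by ring
    _ ≤ θ * m := mul_le_mul_of_nonneg_right hθ hm

/-- the pointwise domination without extra factors: `2(A·t·c) ≤ θ` gives `2(A·(t·m)·c) ≤ θ·m`. [folklore] -/
private theorem dom_one {A t m c θ : ℝ} (hm : 0 ≤ m) (hθ : 2 * (A * t * c) ≤ θ) : 2 * (A * (t * m) * c) ≤ θ * m := by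
  calc 2 * (A * (t * m) * c) = 2 * (A * t * c) * m := by ring
    _ ≤ θ * m := mul_le_mul_of_nonneg_right hθ hm

set_option maxHeartbeats 400000 in
/-- ★★ **THE `StepDirB` LAYER OF THE T³ LEAVES FROM THE LETTER LAYER** — the `KIdx 2 ℓ hd3 hL b₀ b₁` ∕ `geo9K` twin, VERBATIM, of Track A's
`BalabanUVNodes.N06StepDirLayerAtPinsBCZ.stepDirB_layer_of_lettersCZ` (dag-n06-d g9, the helper the d = 4 certificate editions NI–NK import), in the class of
★w1-20520 g3's `Prop7SectET3G0LayerFromThm310.g0_layer_T3_of_thm310_schemas` (the G₀ layer at the same index).  Inputs: `q : PinPrims` (for n06-k's member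
facts, read at `geo9K` through `lemma21Pack_geo9K`); the Hölder probes `𝔭A`, the single-direction letters `Dd ∕ Dds`, the input norm `bHXA`, the Theorem-3.12
letter record `𝔬12 x : B9Thm312Whole.Ops (geo9K x) (bg x) …` (backgrounds `bg` GENERIC — at `bg := Prop7SectET3BgClass.bgT3` it is the record leaf's regime), the
scalar-field Hölder norm `bH13` (cutting constant ≦ κ13) and input norms `bHW13`; the geometry facts `hgeo`; the G₀ layer's outputs in its regime (M₀, a₀):
`hleft` (`LeftStep` at θD), `h33` (`Thm33G0Dir` with constants B12₀, Bh12, Bi12, Bi2₁₂ — the record leaf's `hG0C`.1), `h33R` (`Thm33G0DirR` — `hG0C`.2) and their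
signs; the displayed letter schemas in Theorem 3.12's regime (M12, a12) with `M12 ≤ M₀`, `a₀ ≤ a12`: `hLH3 : Letters313HZ …` (the record leaf's own `hLH3`),
`hDM : Letters313DMZ …` (its `hlettersD`.2), `hX : Thm33G0DirX`, `hdiv : Thm33G0DivR`, the R2-loc class relation `Rel` with multiplicity `mR` (`hmult`),
class-constant distance (`hRel`) and the two localisation facts `hvanishX ∕ hleX` of the input norm against the sharp blocks (dag-n06-l g15's repair of the
false-at-the-pins `hlocX`), the three (3.131) ∕ (3.137) letter schemas `hL3131 : Letters3131 …`, `hL3131H : Letters3131H …`, `hR : Letters3131R …` with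
size `t12·(Mα₀)` at rate δT12, and `hstepL2 : StepL2 …` (passed through); the rates `σS ρS δK12 …` with the ONE relation `δK12 + α_Fδ ≤ ρS ≤ δT12`,
`ρS + σS ≤ min(δ12₀, δ12₃)`.  Output: `∃ θD' (θH θI : ℝ → ℝ) M₀'`, `0 ≤ θD'`, `θH β ≥ 0` for β ∈ [0,1), `θI ε ≥ 0` for ε > 0, `M₀ ≤ M₀'`, and in the regime
(M₀′, a₀): `LeftStep (𝔬12 x) 1 (H x) _ B12₀ δ12₀ (θD'·(Mα₀)) δK12 U` and `StepDirB (𝔬12 x) (𝔭A x) (Dd x) (Dds x) 1 (H x) (bHXA x) _ (θD'·(Mα₀)) (fun β =>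
θH β·(Mα₀)) (fun ε => θI ε·(Mα₀)) δK12 U ∧ StepL2 …` — EXACTLY the shapes of the binders `hleft` ∕ `hstepD` ∕ `hstepL2` of the record-species T³ leaf
`Prop7SectET3N06LeavesRecord.t313_of_pins_T3_completePairMBZ` (`hlen` agrees by proof irrelevance).  Proof: n06-l's engine
`B9Thm312WholeDirBC.stepDirB_of_letters3131LRCZ` once per member, [4] (2.61) at the rate σS (`rowSum261_geo9K`) and p. 398's member facts
(`lemma21Pack_geo9K`) above one threshold each; θ_D′ := max(θ_D, 2(B₀ + κ⁺B₃)tc), θ_H(β), θ_I(ε) := 2((m_R·B₀·L₀ + B_iD(ε))tc) by formula at the row-sum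
constant c; four arithmetic dominations.  A HELPER for the next record-species T³ knit (the `hstepD` ∕ `hleft` rows from print's letters instead of
displayed); nothing of print asserted; N06(d = 3) NOT discharged.
[cite: Balaban1985BackgroundPropagators, Thm 3.12 p.423 + (3.130)–(3.131) pp.421–422 + (3.137)–(3.138) p.423 + (3.42)–(3.45) pp.397–398 + p.398 + p.421; Balaban1984PropagatorsII, Lemma 2.1 (2.61) p.234 + (2.26) p.228] -/
theorem stepDirB_layer_T3_of_lettersCZ {X Y PX PY Z W P : KIdx 2 ℓ hd3 hL b₀ b₁ → Type}
    [∀ x, Fintype (X x)] [∀ x, Fintype (Y x)] [∀ x, Fintype (PX x)] [∀ x, Fintype (PY x)] [∀ x, Fintype (Z x)] [∀ x, Fintype (W x)]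
    [∀ x, Fintype (P x)]
    (q : PinPrims) (hq : q.OK) (H : KIdx 2 ℓ hd3 hL b₀ b₁ → Prop)
    (𝔭A : ∀ x : KIdx 2 ℓ hd3 hL b₀ b₁, HolderProbes (geo9K x) (bg x) (X x) (Y x) (PX x) (PY x))
    (Dd Dds : ∀ x : KIdx 2 ℓ hd3 hL b₀ b₁, (bg x).Cfg → P x → Module.End ℝ (X x → ℝ))
    (bHXA : ∀ x : KIdx 2 ℓ hd3 hL b₀ b₁, ℝ → BlockNorm (toB6 (geo9K x) 1 (H x)) (X x → ℝ))
    (𝔬12 : ∀ x : KIdx 2 ℓ hd3 hL b₀ b₁, B9Thm312Whole.Ops (geo9K x) (bg x) (X x) (Y x) (Z x) (W x))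
    (bH13 : ∀ x : KIdx 2 ℓ hd3 hL b₀ b₁, BlockNorm (toB6 (geo9K x) 1 (H x)) (W x → ℝ)) (κ13 : ℝ) (hκ13 : ∀ x, (bH13 x).κ ≤ κ13)
    (bHW13 : ∀ x : KIdx 2 ℓ hd3 hL b₀ b₁, ℝ → BlockNorm (toB6 (geo9K x) 1 (H x)) (W x → ℝ))
    (hgeo : ∀ x : KIdx 2 ℓ hd3 hL b₀ b₁, GeoOK (geo9K x))
    -- numerics: the core helper's constants ∕ thresholds and the certificate's rates (NO β-∕ε-uniform bounds)
    (B12₀ δ12₀ δK12 B12₃ δ12₃ t12 δT12 ρS σS θD θ2₁₂ M₀ a₀ M12 a12 : ℝ) (Bh12 Bi12 Bq12 BhD13 Bx13 Bx0 BdX BiD BdD : ℝ → ℝ)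
    (Bi2₁₂ : ℝ → ℝ → ℝ)
    (hB12₀ : 0 ≤ B12₀) (hB12₃ : 0 ≤ B12₃) (ht12 : 0 ≤ t12) (hθD : 0 ≤ θD) (hM₀ : 0 < M₀) (hMM : M12 ≤ M₀) (haa : a₀ ≤ a12)
    (hBh12 : ∀ β, 0 ≤ β → β < 1 → 0 ≤ Bh12 β)
    (hBhD13 : ∀ β, 0 ≤ β → β < 1 → 0 ≤ BhD13 β) (hBx13 : ∀ β, 0 ≤ β → β < 1 → 0 ≤ Bx13 β) (hBx0 : ∀ β, 0 ≤ β → β < 1 → 0 ≤ Bx0 β)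
    (hBdX : ∀ β, 0 ≤ β → β < 1 → 0 ≤ BdX β) (hBiD : ∀ ε, 0 < ε → 0 ≤ BiD ε)
    (hσS : 0 < σS) (hρST : ρS ≤ δT12) (hρS₀ : ρS + σS ≤ δ12₀) (hρS₃ : ρS + σS ≤ δ12₃) (hδK0 : 0 ≤ δK12)
    (hδKS : δK12 + q.αF * ((1 - 2 * q.α) * q.δ₀) ≤ ρS)
    -- the core helper's output families in its regime (M₀, a₀)
    (hleft : ∀ x : KIdx 2 ℓ hd3 hL b₀ b₁, M₀ ≤ (geo9K x).M → ∀ α₀ : ℝ, 0 < α₀ → (geo9K x).M * α₀ ≤ a₀ →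
      ∀ U : (bg x).Cfg, (bg x).Reg335 c35 α₀ U → (bg x).Reg336 c35 α₀ U →
        LeftStep (𝔬12 x) 1 (H x) (fun y => (geo9K_len_pos x y).le) B12₀ δ12₀ (θD * ((geo9K x).M * α₀)) δK12 U)
    (h33 : ∀ x : KIdx 2 ℓ hd3 hL b₀ b₁, M₀ ≤ (geo9K x).M → ∀ α₀ : ℝ, 0 < α₀ → (geo9K x).M * α₀ ≤ a₀ →
      ∀ U : (bg x).Cfg, (bg x).Reg335 c35 α₀ U → (bg x).Reg336 c35 α₀ U →
        Thm33G0Dir (𝔬12 x) (𝔭A x) (Dd x) (Dds x) 1 (H x) (bHXA x) B12₀ Bh12 Bi12 Bi2₁₂ δ12₀ U)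
    (h33R : ∀ x : KIdx 2 ℓ hd3 hL b₀ b₁, M₀ ≤ (geo9K x).M → ∀ α₀ : ℝ, 0 < α₀ → (geo9K x).M * α₀ ≤ a₀ →
      ∀ U : (bg x).Cfg, (bg x).Reg335 c35 α₀ U → (bg x).Reg336 c35 α₀ U → Thm33G0DirR (𝔬12 x) (Dds x) 1 (H x) B12₀ δ12₀ U)
    -- the displayed schemas of rows 20–21 in Theorem 3.12's regime (M12, a12)
    (wZ : ∀ x : KIdx 2 ℓ hd3 hL b₀ b₁, (geo9K x).Site → ℝ) (hwZ : ∀ (x : KIdx 2 ℓ hd3 hL b₀ b₁) (y : (geo9K x).Site), 0 < wZ x y)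
    (hLH3 : ∀ x : KIdx 2 ℓ hd3 hL b₀ b₁, M12 ≤ (geo9K x).M → ∀ α₀ : ℝ, 0 < α₀ → (geo9K x).M * α₀ ≤ a12 →
      ∀ U : (bg x).Cfg, (bg x).Reg335 c35 α₀ U → (bg x).Reg336 c35 α₀ U →
        Letters313HZ (𝔬12 x) (𝔭A x) 1 (H x) (hgeo x) (wZ x) (hwZ x) (bH13 x) BhD13 Bx13 δ12₃ U)
    (hDM : ∀ x : KIdx 2 ℓ hd3 hL b₀ b₁, M12 ≤ (geo9K x).M → ∀ α₀ : ℝ, 0 < α₀ → (geo9K x).M * α₀ ≤ a12 →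
      ∀ U : (bg x).Cfg, (bg x).Reg335 c35 α₀ U → (bg x).Reg336 c35 α₀ U →
        Letters313DMZ (𝔬12 x) (𝔭A x) (Dd x) 1 (H x) (hgeo x) (wZ x) (hwZ x) B12₃ Bq12 δ12₃ (bH13 x) U)
    (hX : ∀ x : KIdx 2 ℓ hd3 hL b₀ b₁, M12 ≤ (geo9K x).M → ∀ α₀ : ℝ, 0 < α₀ → (geo9K x).M * α₀ ≤ a12 →
      ∀ U : (bg x).Cfg, (bg x).Reg335 c35 α₀ U → (bg x).Reg336 c35 α₀ U →
        Thm33G0DirX (𝔬12 x) (𝔭A x) (Dd x) 1 (H x) (fun y => (geo9K_len_pos x y).le) (bH13 x) Bx0 BdX δ12₀ δ12₃ U)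
    (hdiv : ∀ x : KIdx 2 ℓ hd3 hL b₀ b₁, M12 ≤ (geo9K x).M → ∀ α₀ : ℝ, 0 < α₀ → (geo9K x).M * α₀ ≤ a12 →
      ∀ U : (bg x).Cfg, (bg x).Reg335 c35 α₀ U → (bg x).Reg336 c35 α₀ U →
        Thm33G0DivR (𝔬12 x) (Dds x) 1 (H x) (fun y => (geo9K_len_pos x y).le) (bHXA x) (bHW13 x) BiD BdD δ12₀ δ12₃ U)
    -- R2-loc (dag-n06-l g15 `Letters313IMBC` ∕ `stepDirB_of_letters3131LRCZ`): the input norm's localisation is read against the fibre blocks through a CLASS relation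
    (Rel : ∀ x : KIdx 2 ℓ hd3 hL b₀ b₁, (geo9K x).Site → (geo9K x).Site → Prop) [∀ x, DecidableRel (Rel x)] (mR : ℝ) (hmR : 0 ≤ mR)
    (hmult : ∀ (x : KIdx 2 ℓ hd3 hL b₀ b₁) (y' : (geo9K x).Site), ((Finset.univ.filter (fun y'' => Rel x y'' y')).card : ℝ) ≤ mR)
    (hRel : ∀ (x : KIdx 2 ℓ hd3 hL b₀ b₁) (a b b' : (geo9K x).Site), Rel x b' b → (geo9K x).dist a b' = (geo9K x).dist a b)
    (hvanishX : ∀ x : KIdx 2 ℓ hd3 hL b₀ b₁, M12 ≤ (geo9K x).M → ∀ α₀ : ℝ, 0 < α₀ → (geo9K x).M * α₀ ≤ a12 →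
      ∀ U : (bg x).Cfg, (bg x).Reg335 c35 α₀ U → (bg x).Reg336 c35 α₀ U →
        ∀ ε : ℝ, 0 < ε → ∀ (y' : (geo9K x).Site) (μ : X x → ℝ), (bHXA x ε).IsLoc y' μ → ∀ y'' : (geo9K x).Site, ¬ Rel x y'' y' →
          (BlockNorm.ofBlocks (toB6 (geo9K x) 1 (H x)) (𝔬12 x).blk).cut y'' μ = 0)
    (hleX : ∀ x : KIdx 2 ℓ hd3 hL b₀ b₁, M12 ≤ (geo9K x).M → ∀ α₀ : ℝ, 0 < α₀ → (geo9K x).M * α₀ ≤ a12 →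
      ∀ U : (bg x).Cfg, (bg x).Reg335 c35 α₀ U → (bg x).Reg336 c35 α₀ U →
        ∀ ε : ℝ, 0 < ε → ∀ (y' : (geo9K x).Site) (μ : X x → ℝ), (bHXA x ε).IsLoc y' μ → ∀ y'' : (geo9K x).Site, Rel x y'' y' →
          (BlockNorm.ofBlocks (toB6 (geo9K x) 1 (H x)) (𝔬12 x).blk).loc y'' ((BlockNorm.ofBlocks (toB6 (geo9K x) 1 (H x)) (𝔬12 x).blk).cut y'' μ) ≤ (bHXA x ε).loc y' μ)
    (Ta Ta₂ Ta' Ta₂' : ∀ x : KIdx 2 ℓ hd3 hL b₀ b₁, (bg x).Cfg → Module.End ℝ (X x → ℝ))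
    (Tb Tb₂ : ∀ x : KIdx 2 ℓ hd3 hL b₀ b₁, (bg x).Cfg → (X x → ℝ) →ₗ[ℝ] (W x → ℝ))
    (Tb' Tb₂' : ∀ x : KIdx 2 ℓ hd3 hL b₀ b₁, (bg x).Cfg → (W x → ℝ) →ₗ[ℝ] (X x → ℝ))
    (hL3131 : ∀ x : KIdx 2 ℓ hd3 hL b₀ b₁, M12 ≤ (geo9K x).M → ∀ α₀ : ℝ, 0 < α₀ → (geo9K x).M * α₀ ≤ a12 →
      ∀ U : (bg x).Cfg, (bg x).Reg335 c35 α₀ U → (bg x).Reg336 c35 α₀ U →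
        Letters3131 (𝔬12 x) (Ta x) (Ta₂ x) (Tb x) (Tb₂ x) 1 (H x) (fun y => (geo9K_len_pos x y).le) (t12 * ((geo9K x).M * α₀)) δT12 U)
    (hL3131H : ∀ x : KIdx 2 ℓ hd3 hL b₀ b₁, M12 ≤ (geo9K x).M → ∀ α₀ : ℝ, 0 < α₀ → (geo9K x).M * α₀ ≤ a12 →
      ∀ U : (bg x).Cfg, (bg x).Reg335 c35 α₀ U → (bg x).Reg336 c35 α₀ U →
        Letters3131H (𝔬12 x) (Tb x) (Tb₂ x) 1 (H x) (fun y => (geo9K_len_pos x y).le) (bH13 x) (t12 * ((geo9K x).M * α₀)) δT12 U)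
    (hR : ∀ x : KIdx 2 ℓ hd3 hL b₀ b₁, M12 ≤ (geo9K x).M → ∀ α₀ : ℝ, 0 < α₀ → (geo9K x).M * α₀ ≤ a12 →
      ∀ U : (bg x).Cfg, (bg x).Reg335 c35 α₀ U → (bg x).Reg336 c35 α₀ U →
        Letters3131R (𝔬12 x) (Ta' x) (Ta₂' x) (Tb' x) (Tb₂' x) 1 (H x) (fun y => (geo9K_len_pos x y).le) (t12 * ((geo9K x).M * α₀)) δT12 U)
    (hstepL2 : ∀ x : KIdx 2 ℓ hd3 hL b₀ b₁, M12 ≤ (geo9K x).M → ∀ α₀ : ℝ, 0 < α₀ → (geo9K x).M * α₀ ≤ a12 →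
      ∀ U : (bg x).Cfg, (bg x).Reg335 c35 α₀ U → (bg x).Reg336 c35 α₀ U →
        StepL2 (𝔬12 x) 1 (H x) (θ2₁₂ * ((geo9K x).M * α₀)) δK12 U) :
    ∃ (θD' : ℝ) (θH θI : ℝ → ℝ) (M₀' : ℝ), 0 ≤ θD' ∧ (∀ β, 0 ≤ β → β < 1 → 0 ≤ θH β) ∧ (∀ ε, 0 < ε → 0 ≤ θI ε) ∧ M₀ ≤ M₀' ∧
      (∀ x : KIdx 2 ℓ hd3 hL b₀ b₁, M₀' ≤ (geo9K x).M → ∀ α₀ : ℝ, 0 < α₀ → (geo9K x).M * α₀ ≤ a₀ →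
        ∀ U : (bg x).Cfg, (bg x).Reg335 c35 α₀ U → (bg x).Reg336 c35 α₀ U →
          LeftStep (𝔬12 x) 1 (H x) (fun y => (geo9K_len_pos x y).le) B12₀ δ12₀ (θD' * ((geo9K x).M * α₀)) δK12 U) ∧
      (∀ x : KIdx 2 ℓ hd3 hL b₀ b₁, M₀' ≤ (geo9K x).M → ∀ α₀ : ℝ, 0 < α₀ → (geo9K x).M * α₀ ≤ a₀ →
        ∀ U : (bg x).Cfg, (bg x).Reg335 c35 α₀ U → (bg x).Reg336 c35 α₀ U →
          StepDirB (𝔬12 x) (𝔭A x) (Dd x) (Dds x) 1 (H x) (bHXA x) (fun y => (geo9K_len_pos x y).le) (θD' * ((geo9K x).M * α₀))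
            (fun β => θH β * ((geo9K x).M * α₀)) (fun ε => θI ε * ((geo9K x).M * α₀)) δK12 U ∧
          StepL2 (𝔬12 x) 1 (H x) (θ2₁₂ * ((geo9K x).M * α₀)) δK12 U) := by
  -- p. 398's member facts at ((1 − 2α)δ₀, α_F) and [4] (2.61) at the rate σS, above ONE threshold each (n06-k ∕ n06-i)
  obtain ⟨ML, -, hfacts, -⟩ :=
    lemma21Pack_geo9K (ℓ := ℓ) (hL := hL) (b₀ := b₀) (b₁ := b₁) H hq.α_pos hq.α_lt
      hq.δ₀_pos hq.αF_pos (by linarith only [hq.αF_lt])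
  obtain ⟨MLσ, cσ, hrow0⟩ := rowSum261_geo9K (d := 2) (ℓ := ℓ) (hd := hd3) (hL := hL) (b₀ := b₀) (b₁ := b₁) σS hσS
  set c : ℝ := max cσ 0 with hc'
  have hc0 : 0 ≤ c := le_max_right _ _
  have hrow : ∀ x : KIdx 2 ℓ hd3 hL b₀ b₁, MLσ ≤ (geo9K x).M → RowSum (toB6 (geo9K x) 1 (H x)) σS c :=
    fun x hM y => (hrow0 x hM y).trans (le_max_left _ _)
  set L₀ : ℝ := ((ℓ + 1 : ℕ) : ℝ) with hL₀
  have hL₀0 : 0 ≤ L₀ := by rw [hL₀]; positivity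
  set κM : ℝ := max κ13 0 with hκM
  have hκM0 : 0 ≤ κM := le_max_right _ _
  -- the step constants BY CHOICE: θ_D′ a number, θ_H and θ_I FUNCTIONS of the exponent (print: B₀(β), B′₀(ε), pp. 397–398)
  set θD' : ℝ := max θD (2 * ((B12₀ + κM * B12₃) * t12 * c)) with hθD'
  set θH : ℝ → ℝ := fun β => 2 * ((Bh12 β + κM * BhD13 β) * t12 * c) + 2 * ((Bh12 β + κM * BdX β) * t12 * c) +
    2 * ((Bx0 β + Bx13 β) * t12 * c * L₀) with hθH
  set θI : ℝ → ℝ := fun ε => 2 * ((mR * B12₀ * L₀ + BiD ε) * t12 * c) with hθI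
  set M₀' : ℝ := max M₀ (max ML MLσ) with hM₀'
  have hθD'0 : 0 ≤ θD' := hθD.trans (le_max_left _ _)
  have hH1 : ∀ β, 0 ≤ β → β < 1 → 0 ≤ 2 * ((Bh12 β + κM * BhD13 β) * t12 * c) := fun β h0 h1 =>
    mul_nonneg (by norm_num) (mul_nonneg (mul_nonneg (add_nonneg (hBh12 β h0 h1) (mul_nonneg hκM0 (hBhD13 β h0 h1))) ht12) hc0)
  have hH2 : ∀ β, 0 ≤ β → β < 1 → 0 ≤ 2 * ((Bh12 β + κM * BdX β) * t12 * c) := fun β h0 h1 =>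
    mul_nonneg (by norm_num) (mul_nonneg (mul_nonneg (add_nonneg (hBh12 β h0 h1) (mul_nonneg hκM0 (hBdX β h0 h1))) ht12) hc0)
  have hH3 : ∀ β, 0 ≤ β → β < 1 → 0 ≤ 2 * ((Bx0 β + Bx13 β) * t12 * c * L₀) := fun β h0 h1 =>
    mul_nonneg (by norm_num) (mul_nonneg (mul_nonneg (mul_nonneg (add_nonneg (hBx0 β h0 h1) (hBx13 β h0 h1)) ht12) hc0) hL₀0)
  have hθH0 : ∀ β, 0 ≤ β → β < 1 → 0 ≤ θH β := fun β h0 h1 => by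
    simp only [hθH]; linarith only [hH1 β h0 h1, hH2 β h0 h1, hH3 β h0 h1]
  have hθI0 : ∀ ε, 0 < ε → 0 ≤ θI ε := fun ε hε => by
    simp only [hθI]
    exact mul_nonneg (by norm_num) (mul_nonneg (mul_nonneg (add_nonneg (mul_nonneg (mul_nonneg hmR hB12₀) hL₀0) (hBiD ε hε)) ht12) hc0)
  have hαFδ : 0 ≤ q.αF * ((1 - 2 * q.α) * q.δ₀) :=
    mul_nonneg hq.αF_pos.le (mul_nonneg (by linarith only [hq.α_lt]) hq.δ₀_pos.le)
  refine ⟨θD', θH, θI, M₀', hθD'0, hθH0, hθI0, le_max_left _ _, fun x hM α₀ hα ha U hU hU' => ?_,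
    fun x hM α₀ hα ha U hU hU' => ?_⟩
  all_goals
    have hM0x : M₀ ≤ (geo9K x).M := (le_max_left _ _).trans hM
    have hM12x : M12 ≤ (geo9K x).M := hMM.trans hM0x
    have hMLx : ML ≤ (geo9K x).M := ((le_max_left _ _).trans (le_max_right _ _)).trans hM
    have hMLσx : MLσ ≤ (geo9K x).M := ((le_max_right _ _).trans (le_max_right _ _)).trans hM
    have ha12x : (geo9K x).M * α₀ ≤ a12 := ha.trans haa
    have hMpos : 0 < (geo9K x).M := lt_of_lt_of_le hM₀ hM0x
    have hMα : 0 ≤ (geo9K x).M * α₀ := mul_nonneg hMpos.le hα.le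
    have hw : ∀ a b : (geo9K x).Site, θD * ((geo9K x).M * α₀) * Real.exp (-(δK12 * (toB6 (geo9K x) 1 (H x)).dist a b)) ≤
        θD' * ((geo9K x).M * α₀) * Real.exp (-(δK12 * (toB6 (geo9K x) 1 (H x)).dist a b)) := fun a b =>
      mul_le_mul_of_nonneg_right (mul_le_mul_of_nonneg_right (le_max_left _ _) hMα) (Real.exp_nonneg _)
  · obtain ⟨he1, hsd, hsd1⟩ := hleft x hM0x α₀ hα ha U hU hU'
    exact ⟨he1, hsd.mono hw, hsd1.mono hw⟩
  · have hκx : (bH13 x).κ ≤ κM := (hκ13 x).trans (le_max_left _ _)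
    have hS := stepDirB_of_letters3131LRCZ (R₀ := 1) (H₀ := H x) (hgeo x) (hfacts x hMLx) (hrow x hMLσx) hc0 hB12₀ hB12₃
      (mul_nonneg ht12 hMα) hBh12 hBhD13 hBx13 hBx0 hBdX hBiD (Rel x) hmR (hmult x) (hRel x) hρST hρS₀ hρS₃ hαFδ hδK0 hδKS
      (θD := θD' * ((geo9K x).M * α₀)) (θH := fun β => θH β * ((geo9K x).M * α₀)) (θI := fun ε => θI ε * ((geo9K x).M * α₀))
      (dom_two hκx hB12₃ ht12 hMα hc0 (le_max_right _ _))
      (fun β hβ0 hβ1 => dom_two hκx (hBhD13 β hβ0 hβ1) ht12 hMα hc0 (by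
        simp only [hθH]; linarith only [hH2 β hβ0 hβ1, hH3 β hβ0 hβ1]))
      (fun β hβ0 hβ1 => dom_two hκx (hBdX β hβ0 hβ1) ht12 hMα hc0 (by
        simp only [hθH]; linarith only [hH1 β hβ0 hβ1, hH3 β hβ0 hβ1]))
      (fun β hβ0 hβ1 => dom_L hMα (by simp only [hθH]; linarith only [hH1 β hβ0 hβ1, hH2 β hβ0 hβ1]))
      (fun ε hε => dom_one hMα (by simp only [hθI]; exact le_rfl))
      (h33 x hM0x α₀ hα ha U hU hU') (h33R x hM0x α₀ hα ha U hU hU') (hLH3 x hM12x α₀ hα ha12x U hU hU')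
      (hDM x hM12x α₀ hα ha12x U hU hU') (hX x hM12x α₀ hα ha12x U hU hU') (hdiv x hM12x α₀ hα ha12x U hU hU')
      (hvanishX x hM12x α₀ hα ha12x U hU hU') (hleX x hM12x α₀ hα ha12x U hU hU') (hL3131 x hM12x α₀ hα ha12x U hU hU')
      (hL3131H x hM12x α₀ hα ha12x U hU hU') (hR x hM12x α₀ hα ha12x U hU hU')
    exact ⟨hS, hstepL2 x hM12x α₀ hα ha12x U hU hU'⟩


/-! ## §2 The R2-loc class relation at the T³ index: `Rel := RelB` (the carrier-block equivalence of the index bonds) -/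

/-- **THE MULTIPLICITY ROW `hmult` AT `Rel := RelB x`, IN THE ENGINE's REAL-VALUED SHAPE**: a carrier block of a T³ member belongs to at most `2·(2+1) = 6`
index bonds (`Prop7SectET3N06LeavesRelZ.card_filter_relB_le`, from n06-i's `B9CarrierBlockMultiplicity.card_sameCarrier_le_kIdx` at `d + 1 = 3`), so
`m_R := 6` serves `stepDirB_layer_T3_of_lettersCZ`. [cite: Balaban1984PropagatorsII, (2.3) p.224 + (2.45) p.231, bookkeeping] -/
theorem relB_mult_real (x : KIdx 2 ℓ hd3 hL b₀ b₁) [DecidableRel (RelB x)] (y' : (geo9K x).Site) :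
    (((Finset.univ : Finset (geo9K x).Site).filter (fun y'' => RelB x y'' y')).card : ℝ) ≤ 6 := by
  have h := card_filter_relB_le x y'
  have h6 : (((Finset.univ : Finset (geo9K x).Site).filter (fun y'' => RelB x y'' y')).card : ℝ) ≤ ((2 * (2 + 1) : ℕ) : ℝ) := by
    exact_mod_cast h
  refine h6.trans (le_of_eq ?_)
  norm_num

omit [∀ x : KIdx 2 ℓ hd3 hL b₀ b₁, Fintype (geo9K x).Site] in
/-- **THE CLASS-CONSTANT DISTANCE ROW `hRel` AT `Rel := RelB x`**: equivalent index bonds sit at the same multiscale distance from every bond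
(`B9CoRealizesRelAtLetters.dist_eq_of_relB` with `relB_refl` in the first slot) — the shape `Rel x b' b → d(a, b') = d(a, b)` the engine reads.
[cite: Balaban1984PropagatorsII, (2.45)–(2.46) p.231, bookkeeping] -/
theorem dist_eq_of_relB_right (x : KIdx 2 ℓ hd3 hL b₀ b₁) (a b b' : (geo9K x).Site) (h : RelB x b' b) :
    (geo9K x).dist a b' = (geo9K x).dist a b :=
  dist_eq_of_relB x (relB_refl x a) h

end Summit.QuantumFields.YangMills.Theorems.Prop7SectET3StepDirLayerFromLetters

end
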